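import Mathlib
import Summits.Ventures.HodgeRepro.Tier4.Common.AdelicDefs
import Summits.Ventures.HodgeRepro.Tier4.Common.CompactOpenLevel
import Summits.Ventures.HodgeRepro.Tier4.Line1.PlaneDefs
import Summits.Ventures.HodgeRepro.Tier4.Line1.RowBasis
import Summits.Ventures.HodgeRepro.Tier4.Line1.RationalConjSystem
import Summits.Ventures.HodgeRepro.Tier4.Line1.AdelicParts

/-!
# Tier4/Line1/SysUniqueFinite — UNIQUENESS over `𝔸_{k,f}` of the homogeneous rational system of J2.b, from p2's
`sys_unique` over `𝔸_k` applied to MIXED adelic matrices (the finite-adelic conjugator with identity archimedean part)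

Blind re-derivation cell `pub-hodge-repro`, Tier 4 (README §9–§10), seat t4-L1-p4 (gen 4); support for
`Tier4/Line1/RationalConjFinite.lean` (t4-plan-1 g2's adjudication S13794, names S13818).  Target tree path
`lean/Summits/Ventures/HodgeRepro/Tier4/Line1/SysUniqueFinite.lean`.  No printed input.

THE STATEMENT.  Let `t ∈ T(𝔸)`, `t′ ∈ T′(𝔸)` and rational matrices `g`, `g₀` with the FINITE-part conjugation identity
`g_f t′_f = t_f g₀,f`; let `(x, y)` be the `E′_𝔸`-scalar of `t` on the row line `W₀` (`w t = x w + y wΩ`, `x² + d y² = 1`)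
and `hreg` the linear regularity of `g₀` (`IsLinRegular`, unfolded).  Then the homogeneous rational system over `𝔸_{k,f}`
— `Y_f` in the commutant of `Ω, P₀, P₁`, `Y′_f` in that of `Ω, Q₀, Q₁`, `Y_f g₀ = g Y′_f`, `P₀ Y_f = 0` — has only the zero
solution (`sys_unique_finPart`).
THE PROOF.  p2's `sys_unique` (RationalConjSystem) is stated over `𝔸_k`; it is applied to the MIXED matrices
`T̃ = mixM 1 t_f`, `T̃⁻¹ = mixM 1 (t⁻¹)_f` (archimedean part the identity, finite part that of `t`), `Γ̃ = mixM (g₀)_∞ g_f`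
and `Γ₀ = adMat g₀`: every hypothesis holds componentwise (`M4_ext`) — the conjugation identity `Γ̃ T̃′ = T̃ Γ₀` is
`g₀,∞ · 1 = 1 · g₀,∞` at infinity and the finite-part hypothesis at the finite places; the scalar relation holds with
`x̃ = (1, x_f)`, `ỹ = (0, y_f)` and `x̃² + d ỹ² = (1, x_f² + d y_f²) = 1`.  An `𝔸_{k,f}`-solution `(Y_f, Y′_f)` embeds as
`(mixM 0 Y_f, mixM 0 Y′_f)` (the archimedean equations are `0 = 0`), and `sys_unique` kills it.
Nothing here says anything about the status of the Hodge conjecture for CM abelian varieties, which is NOT proved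
(HC_CM is NOT proved by anyone in this repository).
-/

set_option autoImplicit false

noncomputable section

namespace Summit.Ventures.HodgeRepro.Tier4.Line1

open Matrix NumberField IsDedekindDomain Summit.Ventures.HodgeRepro.Tier4.Common
open scoped NumberField

section Unique

variable {k : Type} [Field k] [NumberField k] (W : PlaneData k)

/-- **Uniqueness over `𝔸_{k,f}` of the homogeneous rational system** (see the module docstring): for `t ∈ T(𝔸)`,
`t′ ∈ T′(𝔸)` with `g_f t′_f = t_f g₀,f`, the row scalar `(x, y)` of `t` of norm `1`, and `g₀` linearly regular, an
`𝔸_{k,f}`-matrix pair `(Y_f, Y′_f)` in the commutant algebras with `Y_f g₀ = g Y′_f` and `P₀ Y_f = 0` is zero. -/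
theorem sys_unique_finPart {d : k} (hΩ : W.Ω * W.Ω = -(d • (1 : Matrix (Fin 4) (Fin 4) k)))
    (hd : ¬ IsSquare (-d)) {w w₁ : Fin 4 → k} (h0 : w ≠ 0) (h1 : w₁ ≠ 0)
    (hP0 : w ᵥ* W.P 0 = w) (hP1 : w₁ ᵥ* W.P 0 = 0) {t t' : GA W} (ht : t ∈ torusT W) (ht' : t' ∈ torusT' W)
    {g g₀ : Matrix (Fin 4) (Fin 4) k}
    (hΓf : finM k (adMat k g) * finM k (GA.mat W t') = finM k (GA.mat W t) * finM k (adMat k g₀))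
    (hreg : ∀ Z Z' : M4 k, Z * adMat k W.Ω = adMat k W.Ω * Z →
      (∀ i, Z * adMat k (W.P i) = adMat k (W.P i) * Z) → Z' * adMat k W.Ω = adMat k W.Ω * Z' →
      (∀ i, Z' * adMat k (W.Q i) = adMat k (W.Q i) * Z') → Z * adMat k g₀ = adMat k g₀ * Z' →
      ∃ x y : Ad k, Z = x • (1 : M4 k) + y • adMat k W.Ω ∧ Z' = x • (1 : M4 k) + y • adMat k W.Ω)
    {x y : Ad k} (hxy : (algebraMap k (Ad k) ∘ w) ᵥ* GA.mat W t =
      x • (algebraMap k (Ad k) ∘ w) + y • (algebraMap k (Ad k) ∘ (w ᵥ* W.Ω)))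
    (hn : x * x + algebraMap k (Ad k) d * (y * y) = 1)
    {Yf Y'f : Matrix (Fin 4) (Fin 4) (FiniteAdeleRing (𝓞 k) k)}
    (hYΩ : Yf * W.Ω.map (algebraMap k (FiniteAdeleRing (𝓞 k) k)) =
      W.Ω.map (algebraMap k (FiniteAdeleRing (𝓞 k) k)) * Yf)
    (hYP : ∀ i, Yf * (W.P i).map (algebraMap k (FiniteAdeleRing (𝓞 k) k)) =
      (W.P i).map (algebraMap k (FiniteAdeleRing (𝓞 k) k)) * Yf)
    (hY'Ω : Y'f * W.Ω.map (algebraMap k (FiniteAdeleRing (𝓞 k) k)) =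
      W.Ω.map (algebraMap k (FiniteAdeleRing (𝓞 k) k)) * Y'f)
    (hY'Q : ∀ i, Y'f * (W.Q i).map (algebraMap k (FiniteAdeleRing (𝓞 k) k)) =
      (W.Q i).map (algebraMap k (FiniteAdeleRing (𝓞 k) k)) * Y'f)
    (hYΓ : Yf * g₀.map (algebraMap k (FiniteAdeleRing (𝓞 k) k)) =
      g.map (algebraMap k (FiniteAdeleRing (𝓞 k) k)) * Y'f)
    (hP0Y : (W.P 0).map (algebraMap k (FiniteAdeleRing (𝓞 k) k)) * Yf = 0) : Yf = 0 ∧ Y'f = 0 := by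
  -- the inverses of `t`, `t′` in the tori
  have hti : t⁻¹ ∈ torusT W := (torusT W).inv_mem ht
  have hti' : t'⁻¹ ∈ torusT' W := (torusT' W).inv_mem ht'
  have hTiΩ : GA.mat W t⁻¹ * adMat k W.Ω = adMat k W.Ω * GA.mat W t⁻¹ :=
    ((mem_unitaryGroup W _).1 (t⁻¹).2).1
  have hTiP : ∀ i, GA.mat W t⁻¹ * adMat k (W.P i) = adMat k (W.P i) * GA.mat W t⁻¹ := by
    intro i
    fin_cases i
    · exact hti.1
    · exact hti.2
  have hTi'Ω : GA.mat W t'⁻¹ * adMat k W.Ω = adMat k W.Ω * GA.mat W t'⁻¹ :=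
    ((mem_unitaryGroup W _).1 (t'⁻¹).2).1
  have hTi'Q : ∀ i, GA.mat W t'⁻¹ * adMat k (W.Q i) = adMat k (W.Q i) * GA.mat W t'⁻¹ := by
    intro i
    fin_cases i
    · exact hti'.1
    · exact hti'.2
  rw [← finM_adMat] at hYΩ hY'Ω hP0Y
  rw [← finM_adMat, ← finM_adMat] at hYΓ
  have hYP' : ∀ i, Yf * finM k (adMat k (W.P i)) = finM k (adMat k (W.P i)) * Yf := fun i => by
    rw [finM_adMat]; exact hYP i
  have hY'Q' : ∀ i, Y'f * finM k (adMat k (W.Q i)) = finM k (adMat k (W.Q i)) * Y'f := fun i => by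
    rw [finM_adMat]; exact hY'Q i
  -- the mixed conjugators and their inverses
  have hTiT : mixM k 1 (finM k (GA.mat W t⁻¹)) * mixM k 1 (finM k (GA.mat W t)) = 1 := by
    apply M4_ext
    · simp only [infM_mul, infM_mixM, infM_one, Matrix.one_mul]
    · rw [finM_mul, finM_mixM, finM_mixM, ← finM_mul, GA.mat_inv_mul]
  have hTTi : mixM k 1 (finM k (GA.mat W t)) * mixM k 1 (finM k (GA.mat W t⁻¹)) = 1 := by
    apply M4_ext
    · simp only [infM_mul, infM_mixM, infM_one, Matrix.one_mul]
    · rw [finM_mul, finM_mixM, finM_mixM, ← finM_mul, GA.mat_mul_inv]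
  have hT'Ti' : mixM k 1 (finM k (GA.mat W t')) * mixM k 1 (finM k (GA.mat W t'⁻¹)) = 1 := by
    apply M4_ext
    · simp only [infM_mul, infM_mixM, infM_one, Matrix.one_mul]
    · rw [finM_mul, finM_mixM, finM_mixM, ← finM_mul, GA.mat_mul_inv]
  have hmixΩ : ∀ M : M4 k, M * adMat k W.Ω = adMat k W.Ω * M →
      mixM k 1 (finM k M) * adMat k W.Ω = adMat k W.Ω * mixM k 1 (finM k M) := by
    intro M hM
    apply M4_ext
    · simp only [infM_mul, infM_mixM, Matrix.one_mul, Matrix.mul_one]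
    · rw [finM_mul, finM_mul, finM_mixM, ← finM_mul, hM, finM_mul]
  have hmixA : ∀ (M : M4 k) (A : Matrix (Fin 4) (Fin 4) k), M * adMat k A = adMat k A * M →
      mixM k 1 (finM k M) * adMat k A = adMat k A * mixM k 1 (finM k M) := by
    intro M A hM
    apply M4_ext
    · simp only [infM_mul, infM_mixM, Matrix.one_mul, Matrix.mul_one]
    · rw [finM_mul, finM_mul, finM_mixM, ← finM_mul, hM, finM_mul]
  -- the mixed conjugation identity `Γ̃ T̃′ = T̃ Γ₀`
  have hΓmix : mixM k (infM k (adMat k g₀)) (finM k (adMat k g)) * mixM k 1 (finM k (GA.mat W t')) =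
      mixM k 1 (finM k (GA.mat W t)) * adMat k g₀ := by
    apply M4_ext
    · simp only [infM_mul, infM_mixM, Matrix.one_mul, Matrix.mul_one]
    · rw [finM_mul, finM_mul, finM_mixM, finM_mixM]
      exact hΓf
  -- the scalar relation and its norm on the mixed conjugator
  have hxyf := congrArg (finV k) hxy
  rw [finV_vecMul, finV_add, finV_smul, finV_smul, finV_algebraMap_comp, finV_algebraMap_comp] at hxyf
  have hxymix : (algebraMap k (Ad k) ∘ w) ᵥ* mixM k 1 (finM k (GA.mat W t)) =
      mkAd k 1 (finPart k x) • (algebraMap k (Ad k) ∘ w) +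
        mkAd k 0 (finPart k y) •
          (algebraMap k (Ad k) ∘ (w ᵥ* W.Ω)) := by
    apply V4_ext
    · rw [infV_vecMul, infM_mixM, Matrix.vecMul_one, infV_add, infV_smul, infV_smul,
        infV_algebraMap_comp, infV_algebraMap_comp, infPart_mkAd, infPart_mkAd, one_smul, zero_smul, add_zero]
    · rw [finV_vecMul, finM_mixM, finV_add, finV_smul, finV_smul, finV_algebraMap_comp,
        finV_algebraMap_comp, finPart_mkAd, finPart_mkAd]
      exact hxyf
  have hnf := congrArg (finPart k) hn
  rw [map_add, map_mul, map_mul, map_mul, map_one, finPart_algebraMap] at hnf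
  have hnmix : mkAd k 1 (finPart k x) *
      mkAd k 1 (finPart k x) +
      algebraMap k (Ad k) d * (mkAd k 0 (finPart k y) *
        mkAd k 0 (finPart k y)) = 1 := by
    apply Ad_ext
    · rw [map_add, map_mul, map_mul, map_mul, map_one, infPart_mkAd, infPart_mkAd, infPart_algebraMap,
        mul_one, mul_zero, mul_zero, add_zero]
    · rw [map_add, map_mul, map_mul, map_mul, map_one, finPart_mkAd, finPart_mkAd, finPart_algebraMap]
      exact hnf
  -- the embedded homogeneous solution
  have hYΩmix : mixM k 0 Yf * adMat k W.Ω = adMat k W.Ω * mixM k 0 Yf := by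
    apply M4_ext
    · simp only [infM_mul, infM_mixM, Matrix.zero_mul, Matrix.mul_zero]
    · rw [finM_mul, finM_mul, finM_mixM]
      exact hYΩ
  have hYPmix : ∀ i, mixM k 0 Yf * adMat k (W.P i) = adMat k (W.P i) * mixM k 0 Yf := fun i => by
    apply M4_ext
    · simp only [infM_mul, infM_mixM, Matrix.zero_mul, Matrix.mul_zero]
    · rw [finM_mul, finM_mul, finM_mixM]
      exact hYP' i
  have hY'Ωmix : mixM k 0 Y'f * adMat k W.Ω = adMat k W.Ω * mixM k 0 Y'f := by
    apply M4_ext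
    · simp only [infM_mul, infM_mixM, Matrix.zero_mul, Matrix.mul_zero]
    · rw [finM_mul, finM_mul, finM_mixM]
      exact hY'Ω
  have hY'Qmix : ∀ i, mixM k 0 Y'f * adMat k (W.Q i) = adMat k (W.Q i) * mixM k 0 Y'f := fun i => by
    apply M4_ext
    · simp only [infM_mul, infM_mixM, Matrix.zero_mul, Matrix.mul_zero]
    · rw [finM_mul, finM_mul, finM_mixM]
      exact hY'Q' i
  have hYΓmix : mixM k 0 Yf * adMat k g₀ =
      mixM k (infM k (adMat k g₀)) (finM k (adMat k g)) * mixM k 0 Y'f := by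
    apply M4_ext
    · simp only [infM_mul, infM_mixM, Matrix.zero_mul, Matrix.mul_zero]
    · rw [finM_mul, finM_mul, finM_mixM, finM_mixM, finM_mixM]
      exact hYΓ
  have hP0Ymix : adMat k (W.P 0) * mixM k 0 Yf = 0 := by
    apply M4_ext
    · simp only [infM_mul, infM_mixM, Matrix.mul_zero, infM_zero]
    · rw [finM_mul, finM_mixM, hP0Y, finM_zero]
  obtain ⟨hY0, hY'0⟩ := sys_unique W hΩ hd h0 h1 hP0 hP1 hTiT hTTi hT'Ti'
    (hmixΩ _ hTiΩ) (fun i => hmixA _ _ (hTiP i)) (hmixΩ _ hTi'Ω) (fun i => hmixA _ _ (hTi'Q i))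
    hΓmix hreg hxymix hnmix hYΩmix hYPmix hY'Ωmix hY'Qmix hYΓmix hP0Ymix
  refine ⟨?_, ?_⟩
  · have := congrArg (finM k) hY0
    rwa [finM_mixM, finM_zero] at this
  · have := congrArg (finM k) hY'0
    rwa [finM_mixM, finM_zero] at this

end Unique

end Summit.Ventures.HodgeRepro.Tier4.Line1

end
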